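import Summits.BirchSwinnertonDyer.BirchSwinnertonDyer.Theorems.GoldfeldAllTwistsTwoConverseTwinEvenTwistTwoAdic
import HarnessLib

set_option linter.dupNamespace false -- namespace `…BirchSwinnertonDyer.BirchSwinnertonDyer…` is the cell's (D-0017 nested layout)
set_option autoImplicit false

/-!
# Twin″ (item 19140), LINE B⁗ T3-D part 3b: the `2`-adic kills for the DUAL Selmer set `S′ = S(84qp, −28q²p²)` of
# `49a1^{(−2qp)}` (`q ≡ 3 (mod 4)`, `p ≡ 5 (mod 8)`)

Cell `bsd-goldfeld`, seat `bsd-goldfeld-s1p-c3x` (gen 10); planner ORDER (cccxvii) «LINE B⁗ — TRANCHE 3», object T3-D (= N3).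
`--supports stmt-BirchSwinnertonDyer-19140` as a HELPER. FACT-FREE (no fact binder, no definition, no `sorry`).

METHOD (normalisation to numeric quartics, as `…TwinEvenTwistTwoAdic`): `5p`, and `3q` resp. `−q` (for `q ≡ 3` resp. `7 (mod 8)`),
are squares in `ℚ₂` (`KramerLocal.padicTwo_isSquare_intCast`). §1 proves the two rescalings this needs — a COMMON factor `n` of
`(a, d, d′)` may be replaced by `n₀` when `n n₀ ∈ 1 + 8ℤ` (`isSoluble_two_of_common_factor`), and `(n a₁, d, n² e₁) ↦ (n₀ a₁, d, n₀² e₁)`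
(`isSoluble_two_of_sq_factor`, substitution `z ↦ √(n n₀)·z/n₀`). §2: the three numeric kills `(1260; 5, −1260)`, `(1260; −35, 180)`,
`(1260; −30, 210)` by residues mod `8/32/64` (the `q ≡ 3 (8)` shapes; the `q ≡ 7 (8)` shapes are the cell's `(−420; 5, −140)`,
`(−420; −35, 20)`, `(−420; 10, −70)` of `not_isSoluble_two_normalised_twoPosTwist`). §3: the eight classes of `S′` that die at `2`:
`p, −7p, −2qp, 14qp` for all `q ≡ 3 (mod 4)`, and `−qp, 7qp, 2p, −14p` when `q ≡ 7 (mod 8)`.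
HONEST FRAMING: local lemmas only; no `BSD(W,2)` is proved; BSD is not proved by any of this.

References: [SilvermanAEC2009] Prop. X.4.9, Example X.4.10; [Serre1973] Ch. II §3.3 Thm 4.
-/

noncomputable section

open scoped Classical

open Literature.NumberTheory.EllipticCurves

namespace Summit.BirchSwinnertonDyer.BirchSwinnertonDyer.Theorems.GoldfeldGoodTwists

/-! ## §1 Two rescalings over `ℚ₂` -/

/-- **Common factor.** If `n n₀ ≡ 1 (mod 8)` (so `n n₀ = v²` in `ℚ₂`), a `ℚ₂`-point of `w² = n·(d₀u⁴ + a₀u²z² + e₀z⁴)` gives one of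
`w² = n₀·(d₀u⁴ + a₀u²z² + e₀z⁴)` (`w ↦ n₀w/v`). [cite: Serre1973, Ch. II §3.3 Thm 4] -/
theorem isSoluble_two_of_common_factor {n n₀ : ℤ} (h8 : (8 : ℤ) ∣ n₀ * n - 1) {a d d' a₀ d₀ e₀ : ℤ}
    (ha : a = n * a₀) (hd : d = n * d₀) (hd' : d' = n * e₀)
    (h : ((twoIsogenyQuartic a d d').map (Int.castRingHom ℚ_[2])).IsSoluble) :
    ((twoIsogenyQuartic (n₀ * a₀) (n₀ * d₀) (n₀ * e₀)).map (Int.castRingHom ℚ_[2])).IsSoluble := by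
  obtain ⟨x, y, w, h0, hw⟩ := h
  rw [eval_map_twoIsogenyQuartic] at hw
  simp only [eq_intCast] at hw
  subst ha hd hd'
  push_cast at hw
  have hn : n ≠ 0 := by rintro rfl; norm_num at h8
  have hn₀ : n₀ ≠ 0 := by rintro rfl; norm_num at h8
  have hnQ : (n : ℚ_[2]) ≠ 0 := by exact_mod_cast hn
  have hn₀Q : (n₀ : ℚ_[2]) ≠ 0 := by exact_mod_cast hn₀
  obtain ⟨v, hv⟩ := KramerLocal.padicTwo_isSquare_intCast h8
  push_cast at hv
  have hv0 : v ≠ 0 := by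
    rintro rfl
    exact mul_ne_zero hn₀Q hnQ (by simpa using hv)
  refine ⟨x, y, n₀ * w / v, h0, ?_⟩
  rw [eval_map_twoIsogenyQuartic]
  simp only [eq_intCast]
  push_cast
  rw [div_pow, div_eq_iff (pow_ne_zero 2 hv0)]
  linear_combination ((n₀ : ℚ_[2])) ^ 2 * hw +
    (n₀ : ℚ_[2]) * ((d₀ : ℚ_[2]) * x ^ 4 + (a₀ : ℚ_[2]) * x ^ 2 * y ^ 2 + (e₀ : ℚ_[2]) * y ^ 4) * hv

/-- **Square factor on the `z`-side.** If `n n₀ ≡ 1 (mod 8)` (`n n₀ = v²` in `ℚ₂`), a `ℚ₂`-point of `w² = d u⁴ + n a₁ u²z² + n² e₁ z⁴`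
gives one of `w² = d u⁴ + n₀ a₁ u²z² + n₀² e₁ z⁴` (`z ↦ v z/n₀`). [cite: Serre1973, Ch. II §3.3 Thm 4] -/
theorem isSoluble_two_of_sq_factor {n n₀ : ℤ} (h8 : (8 : ℤ) ∣ n₀ * n - 1) {a d d' a₁ e₁ : ℤ}
    (ha : a = n * a₁) (hd' : d' = n ^ 2 * e₁)
    (h : ((twoIsogenyQuartic a d d').map (Int.castRingHom ℚ_[2])).IsSoluble) :
    ((twoIsogenyQuartic (n₀ * a₁) d (n₀ ^ 2 * e₁)).map (Int.castRingHom ℚ_[2])).IsSoluble := by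
  obtain ⟨x, y, w, h0, hw⟩ := h
  rw [eval_map_twoIsogenyQuartic] at hw
  simp only [eq_intCast] at hw
  subst ha hd'
  push_cast at hw
  have hn₀ : n₀ ≠ 0 := by rintro rfl; norm_num at h8
  have hn₀Q : (n₀ : ℚ_[2]) ≠ 0 := by exact_mod_cast hn₀
  obtain ⟨v, hv⟩ := KramerLocal.padicTwo_isSquare_intCast h8
  push_cast at hv
  have hv0 : v ≠ 0 := by
    rintro rfl
    have hnQ : (n : ℚ_[2]) ≠ 0 := by
      have hn : n ≠ 0 := by rintro rfl; norm_num at h8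
      exact_mod_cast hn
    exact mul_ne_zero hn₀Q hnQ (by simpa using hv)
  have hy2 : (n₀ : ℚ_[2]) * (v * y / n₀) ^ 2 = n * y ^ 2 := by
    rw [div_pow, ← mul_div_assoc, div_eq_iff (pow_ne_zero 2 hn₀Q)]
    linear_combination (-((n₀ : ℚ_[2]) * y ^ 2)) * hv
  refine ⟨x, v * y / n₀, w, ?_, ?_⟩
  · rcases h0 with hx | hy
    · exact Or.inl hx
    · exact Or.inr (div_ne_zero (mul_ne_zero hv0 hy) hn₀Q)
  · rw [eval_map_twoIsogenyQuartic]
    simp only [eq_intCast]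
    push_cast
    linear_combination hw - ((a₁ : ℚ_[2]) * x ^ 2) * hy2 -
      ((e₁ : ℚ_[2]) * ((n₀ : ℚ_[2]) * (v * y / n₀) ^ 2 + n * y ^ 2)) * hy2

/-! ## §2 Three numeric kills (the `q ≡ 3 (mod 8)` shapes, `a = 1260`) -/

/-- `ℤ/2ᵏ` keys for `(1260; 5, −1260)`: chart `z = 1` mod `8`, chart `u = 1` mod `32`. [folklore] -/
private theorem keys3_one :
    (∀ T S : ZMod (2 ^ 3), S ^ 2 ≠ ((5 : ℤ) : ZMod (2 ^ 3)) + ((1260 : ℤ) : ZMod (2 ^ 3)) * T ^ 2 +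
      ((-1260 : ℤ) : ZMod (2 ^ 3)) * T ^ 4) ∧
    (∀ T S : ZMod (2 ^ 5), S ^ 2 ≠ ((-1260 : ℤ) : ZMod (2 ^ 5)) + ((1260 : ℤ) : ZMod (2 ^ 5)) * T ^ 2 +
      ((5 : ℤ) : ZMod (2 ^ 5)) * T ^ 4) := by
  refine ⟨?_, ?_⟩ <;> decide

/-- `ℤ/2ᵏ` keys for `(1260; −35, 180)`: chart `z = 1` mod `8`, chart `u = 1` mod `32`. [folklore] -/
private theorem keys3_negSeven :
    (∀ T S : ZMod (2 ^ 3), S ^ 2 ≠ ((-35 : ℤ) : ZMod (2 ^ 3)) + ((1260 : ℤ) : ZMod (2 ^ 3)) * T ^ 2 +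
      ((180 : ℤ) : ZMod (2 ^ 3)) * T ^ 4) ∧
    (∀ T S : ZMod (2 ^ 5), S ^ 2 ≠ ((180 : ℤ) : ZMod (2 ^ 5)) + ((1260 : ℤ) : ZMod (2 ^ 5)) * T ^ 2 +
      ((-35 : ℤ) : ZMod (2 ^ 5)) * T ^ 4) := by
  refine ⟨?_, ?_⟩ <;> decide

/-- `ℤ/2ᵏ` keys for `(1260; −30, 210)`: both charts mod `64`. [folklore] -/
private theorem keys3_two :
    (∀ T S : ZMod (2 ^ 6), S ^ 2 ≠ ((-30 : ℤ) : ZMod (2 ^ 6)) + ((1260 : ℤ) : ZMod (2 ^ 6)) * T ^ 2 +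
      ((210 : ℤ) : ZMod (2 ^ 6)) * T ^ 4) ∧
    (∀ T S : ZMod (2 ^ 6), S ^ 2 ≠ ((210 : ℤ) : ZMod (2 ^ 6)) + ((1260 : ℤ) : ZMod (2 ^ 6)) * T ^ 2 +
      ((-30 : ℤ) : ZMod (2 ^ 6)) * T ^ 4) := by
  refine ⟨?_, ?_⟩ <;> decide +kernel

/-- **The three `q ≡ 3 (mod 8)`-shape numeric kills**: `(1260; 5, −1260)`, `(1260; −35, 180)`, `(1260; −30, 210)` have no
non-trivial `ℚ₂`-point. [cite: SilvermanAEC2009, Prop. X.4.9 and Example X.4.10] -/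
theorem not_isSoluble_two_normalised_three :
    ¬ ((twoIsogenyQuartic 1260 5 (-1260)).map (Int.castRingHom ℚ_[2])).IsSoluble ∧
    ¬ ((twoIsogenyQuartic 1260 (-35) 180).map (Int.castRingHom ℚ_[2])).IsSoluble ∧
    ¬ ((twoIsogenyQuartic 1260 (-30) 210).map (Int.castRingHom ℚ_[2])).IsSoluble := by
  obtain ⟨c1, c1'⟩ := keys3_one
  obtain ⟨c7, c7'⟩ := keys3_negSeven
  obtain ⟨c2, c2'⟩ := keys3_two
  exact ⟨not_isSoluble_two_of_padicInt_charts (padicInt_two_sq_ne_of_zmodPow 3 c1) (padicInt_two_sq_ne_of_zmodPow 5 c1'),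
    not_isSoluble_two_of_padicInt_charts (padicInt_two_sq_ne_of_zmodPow 3 c7) (padicInt_two_sq_ne_of_zmodPow 5 c7'),
    not_isSoluble_two_of_padicInt_charts (padicInt_two_sq_ne_of_zmodPow 6 c2) (padicInt_two_sq_ne_of_zmodPow 6 c2')⟩

/-! ## §3 The eight classes of `S′ = S(84qp, −28q²p²)` that die at `2` -/

section Classes
variable {q p : ℕ}

/-- Engine, common-factor type: `d = pq·d₁`, `d′ = pq·e₁` ⇒ after `p ↦ 5`, `q ↦ n₀` the class is the numeric quartic
`(420n₀; 5n₀d₁, 5n₀e₁)`. [cite: Serre1973, Ch. II §3.3 Thm 4] -/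
private theorem kill_common (hp8 : p % 8 = 5) {n₀ : ℤ} (h8 : (8 : ℤ) ∣ n₀ * q - 1) {a d d' d₁ e₁ : ℤ}
    (ha : a = 84 * ((q : ℤ) * p)) (hd : d = p * (q * d₁)) (hd' : d' = p * (q * e₁))
    (hk : ¬ ((twoIsogenyQuartic (n₀ * 420) (n₀ * (5 * d₁)) (n₀ * (5 * e₁))).map (Int.castRingHom ℚ_[2])).IsSoluble) :
    ¬ ((twoIsogenyQuartic a d d').map (Int.castRingHom ℚ_[2])).IsSoluble := fun h ↦ by
  have h5 := isSoluble_two_five_of_fiveModEight hp8 (a₀ := 84 * q) (d₀ := q * d₁) (e₀ := q * e₁) (by rw [ha]; ring) hd hd' h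
  exact hk (isSoluble_two_of_common_factor h8 (a₀ := 420) (d₀ := 5 * d₁) (e₀ := 5 * e₁) (by ring) (by ring) (by ring) h5)

/-- Engine, square-factor type: `d = p·d₁`, `d′ = pq²·e₁` ⇒ after `p ↦ 5`, `q ↦ n₀` the class is the numeric quartic
`(420n₀; 5d₁, 5n₀²e₁)`. [cite: Serre1973, Ch. II §3.3 Thm 4] -/
private theorem kill_sq (hp8 : p % 8 = 5) {n₀ : ℤ} (h8 : (8 : ℤ) ∣ n₀ * q - 1) {a d d' d₁ e₁ : ℤ}
    (ha : a = 84 * ((q : ℤ) * p)) (hd : d = p * d₁) (hd' : d' = p * (q ^ 2 * e₁))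
    (hk : ¬ ((twoIsogenyQuartic (n₀ * 420) (5 * d₁) (n₀ ^ 2 * (5 * e₁))).map (Int.castRingHom ℚ_[2])).IsSoluble) :
    ¬ ((twoIsogenyQuartic a d d').map (Int.castRingHom ℚ_[2])).IsSoluble := fun h ↦ by
  have h5 := isSoluble_two_five_of_fiveModEight hp8 (a₀ := 84 * q) (d₀ := d₁) (e₀ := q ^ 2 * e₁) (by rw [ha]; ring) hd hd' h
  exact hk (isSoluble_two_of_sq_factor h8 (a₁ := 420) (e₁ := 5 * e₁) (by ring) (by ring) h5)

/-- `q ≡ 3 (mod 4)`: `q ≡ 3 (mod 8)` (then `3q ≡ 1 (mod 8)`) or `q ≡ 7 (mod 8)` (then `−q ≡ 1 (mod 8)`). [folklore] -/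
private theorem eight_dvd_cases (hq4 : q % 4 = 3) : (8 : ℤ) ∣ 3 * q - 1 ∨ (8 : ℤ) ∣ -1 * q - 1 := by omega

/-- **Class `p` of `S′`** (`d′ = −28q²p`) has no `ℚ₂`-point. [cite: SilvermanAEC2009, Prop. X.4.9 and Example X.4.10] -/
theorem not_isSoluble_two_dual_p (hq4 : q % 4 = 3) (hp8 : p % 8 = 5) {a d d' : ℤ} (ha : a = 84 * ((q : ℤ) * p))
    (hd : d = p) (hd' : d' = -28 * (q : ℤ) ^ 2 * p) : ¬ ((twoIsogenyQuartic a d d').map (Int.castRingHom ℚ_[2])).IsSoluble := by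
  obtain ⟨u1, u7, u2⟩ := not_isSoluble_two_normalised_three
  obtain ⟨-, -, -, k4, k5, k6⟩ := not_isSoluble_two_normalised_twoPosTwist
  rcases eight_dvd_cases hq4 with h8 | h8
  · exact kill_sq hp8 h8 ha (d₁ := 1) (e₁ := -28) (by rw [hd]; ring) (by rw [hd']; ring) (by norm_num; exact u1)
  · exact kill_sq hp8 h8 ha (d₁ := 1) (e₁ := -28) (by rw [hd]; ring) (by rw [hd']; ring) (by norm_num; exact k4)

/-- **Class `−7p` of `S′`** (`d′ = 4q²p`) has no `ℚ₂`-point. [cite: SilvermanAEC2009, Prop. X.4.9 and Example X.4.10] -/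
theorem not_isSoluble_two_dual_negSevenP (hq4 : q % 4 = 3) (hp8 : p % 8 = 5) {a d d' : ℤ} (ha : a = 84 * ((q : ℤ) * p))
    (hd : d = -7 * (p : ℤ)) (hd' : d' = 4 * (q : ℤ) ^ 2 * p) : ¬ ((twoIsogenyQuartic a d d').map (Int.castRingHom ℚ_[2])).IsSoluble := by
  obtain ⟨u1, u7, u2⟩ := not_isSoluble_two_normalised_three
  obtain ⟨-, -, -, k4, k5, k6⟩ := not_isSoluble_two_normalised_twoPosTwist
  rcases eight_dvd_cases hq4 with h8 | h8
  · exact kill_sq hp8 h8 ha (d₁ := -7) (e₁ := 4) (by rw [hd]; ring) (by rw [hd']; ring) (by norm_num; exact u7)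
  · exact kill_sq hp8 h8 ha (d₁ := -7) (e₁ := 4) (by rw [hd]; ring) (by rw [hd']; ring) (by norm_num; exact k6)

/-- **Class `−2qp` of `S′`** (`d′ = 14qp`) has no `ℚ₂`-point. [cite: SilvermanAEC2009, Prop. X.4.9 and Example X.4.10] -/
theorem not_isSoluble_two_dual_negTwoQP (hq4 : q % 4 = 3) (hp8 : p % 8 = 5) {a d d' : ℤ} (ha : a = 84 * ((q : ℤ) * p))
    (hd : d = -2 * ((q : ℤ) * p)) (hd' : d' = 14 * ((q : ℤ) * p)) :
    ¬ ((twoIsogenyQuartic a d d').map (Int.castRingHom ℚ_[2])).IsSoluble := by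
  obtain ⟨u1, u7, u2⟩ := not_isSoluble_two_normalised_three
  obtain ⟨-, -, -, k4, k5, k6⟩ := not_isSoluble_two_normalised_twoPosTwist
  rcases eight_dvd_cases hq4 with h8 | h8
  · exact kill_common hp8 h8 ha (d₁ := -2) (e₁ := 14) (by rw [hd]; ring) (by rw [hd']; ring) (by norm_num; exact u2)
  · exact kill_common hp8 h8 ha (d₁ := -2) (e₁ := 14) (by rw [hd]; ring) (by rw [hd']; ring) (by norm_num; exact k5)

/-- **Class `14qp` of `S′`** (`d′ = −2qp`) has no `ℚ₂`-point. [cite: SilvermanAEC2009, Prop. X.4.9 and Example X.4.10] -/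
theorem not_isSoluble_two_dual_fourteenQP (hq4 : q % 4 = 3) (hp8 : p % 8 = 5) {a d d' : ℤ} (ha : a = 84 * ((q : ℤ) * p))
    (hd : d = 14 * ((q : ℤ) * p)) (hd' : d' = -2 * ((q : ℤ) * p)) :
    ¬ ((twoIsogenyQuartic a d d').map (Int.castRingHom ℚ_[2])).IsSoluble := by
  rw [isSoluble_map_twoIsogenyQuartic_comm]
  exact not_isSoluble_two_dual_negTwoQP hq4 hp8 ha hd' hd

/-- **Class `−qp` of `S′`** (`d′ = 28qp`), `q ≡ 7 (mod 8)`: no `ℚ₂`-point. [cite: SilvermanAEC2009, Prop. X.4.9 and Example X.4.10] -/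
theorem not_isSoluble_two_dual_negQP (hq8 : q % 8 = 7) (hp8 : p % 8 = 5) {a d d' : ℤ} (ha : a = 84 * ((q : ℤ) * p))
    (hd : d = -1 * ((q : ℤ) * p)) (hd' : d' = 28 * ((q : ℤ) * p)) :
    ¬ ((twoIsogenyQuartic a d d').map (Int.castRingHom ℚ_[2])).IsSoluble := by
  obtain ⟨-, -, -, k4, k5, k6⟩ := not_isSoluble_two_normalised_twoPosTwist
  exact kill_common hp8 (n₀ := -1) (by omega) ha (d₁ := -1) (e₁ := 28) (by rw [hd]; ring) (by rw [hd']; ring)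
    (by norm_num; exact k4)

/-- **Class `7qp` of `S′`** (`d′ = −4qp`), `q ≡ 7 (mod 8)`: no `ℚ₂`-point. [cite: SilvermanAEC2009, Prop. X.4.9 and Example X.4.10] -/
theorem not_isSoluble_two_dual_sevenQP (hq8 : q % 8 = 7) (hp8 : p % 8 = 5) {a d d' : ℤ} (ha : a = 84 * ((q : ℤ) * p))
    (hd : d = 7 * ((q : ℤ) * p)) (hd' : d' = -4 * ((q : ℤ) * p)) :
    ¬ ((twoIsogenyQuartic a d d').map (Int.castRingHom ℚ_[2])).IsSoluble := by
  obtain ⟨-, -, -, k4, k5, k6⟩ := not_isSoluble_two_normalised_twoPosTwist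
  exact kill_common hp8 (n₀ := -1) (by omega) ha (d₁ := 7) (e₁ := -4) (by rw [hd]; ring) (by rw [hd']; ring)
    (by norm_num; exact k6)

/-- **Class `2p` of `S′`** (`d′ = −14q²p`), `q ≡ 7 (mod 8)`: no `ℚ₂`-point. [cite: SilvermanAEC2009, Prop. X.4.9 and Example X.4.10] -/
theorem not_isSoluble_two_dual_twoP (hq8 : q % 8 = 7) (hp8 : p % 8 = 5) {a d d' : ℤ} (ha : a = 84 * ((q : ℤ) * p))
    (hd : d = 2 * (p : ℤ)) (hd' : d' = -14 * (q : ℤ) ^ 2 * p) :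
    ¬ ((twoIsogenyQuartic a d d').map (Int.castRingHom ℚ_[2])).IsSoluble := by
  obtain ⟨-, -, -, k4, k5, k6⟩ := not_isSoluble_two_normalised_twoPosTwist
  exact kill_sq hp8 (n₀ := -1) (by omega) ha (d₁ := 2) (e₁ := -14) (by rw [hd]; ring) (by rw [hd']; ring)
    (by norm_num; exact k5)

/-- **Class `−14p` of `S′`** (`d′ = 2q²p`), `q ≡ 7 (mod 8)`: no `ℚ₂`-point. [cite: SilvermanAEC2009, Prop. X.4.9 and Example X.4.10] -/
theorem not_isSoluble_two_dual_negFourteenP (hq8 : q % 8 = 7) (hp8 : p % 8 = 5) {a d d' : ℤ} (ha : a = 84 * ((q : ℤ) * p))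
    (hd : d = -14 * (p : ℤ)) (hd' : d' = 2 * (q : ℤ) ^ 2 * p) :
    ¬ ((twoIsogenyQuartic a d d').map (Int.castRingHom ℚ_[2])).IsSoluble := by
  obtain ⟨-, -, -, k4, k5, k6⟩ := not_isSoluble_two_normalised_twoPosTwist
  exact kill_sq hp8 (n₀ := -1) (by omega) ha (d₁ := -14) (e₁ := 2) (by rw [hd]; ring) (by rw [hd']; ring)
    (by norm_num; rw [isSoluble_map_twoIsogenyQuartic_comm]; exact k5)

end Classes

end Summit.BirchSwinnertonDyer.BirchSwinnertonDyer.Theorems.GoldfeldGoodTwists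

end
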